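import Summits.BirchSwinnertonDyer.Rank1Residual.ManinAdditive.TowerExtension
import Summits.BirchSwinnertonDyer.BirchSwinnertonDyer.Theorems.ManinLocalTwoThreeLemmaE

/-!
# q-Farey EDGE TRANSPORT and q-ADIC CUSPS (cell bsd-f2-manin, analytic lens g30, MEMO-an §72.3 / §72.7 ladder rung L4:
# the arithmetic half of the orbit-graph instantiation E-an-141 ⟹ E-an-140 `QFareyFibreConnected`)

Summit `BirchSwinnertonDyer`, route `ManinLocalTwoThree`, cruxes C3 `ManinPrimeToThreeAtNine` (stmt-BirchSwinnertonDyer-22968) / C2 `ManinOddAtFour`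
(stmt-…-22967).  Vertices of the q-Farey graph (`TowerExtension.QFareyAdj N q`) are written as rationals `x` (vertex `(x.num, x.den)`); a
Möbius map `x ↦ (a x + b)/(c x + d)` with INTEGRAL entries, determinant `qᵏ`, `N ∣ c` and `d ≡ ±qⁱ (mod N)` — the integral form of an
element of the S-congruence group `Γ_S^{±q}(N) ⊂ SL₂(ℤ[1/q])` — is shown to

* have non-vanishing denominator on the fibre (`moebius_den_ne_zero`, `N ≥ 2`),
* preserve the denominator fibre `±⟨q⟩ ⊂ (ℤ/N)ˣ` (`inFibre_den_moebius`: the reduced image is `P/R` divided by a power of `q` — adjugate trick),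
* transport q-Farey edges (`qFareyAdj_moebius`: cross-differences scale by the determinant),

(LEMMA T of the cell's PROOFS-an-72 §3).  The q-adic cusps, the orbit-graph predicate and the `SL₂(ℤ[1/q])` layer are the sibling files
`…QFareyCusps` / `…QFareyFibreConnected`.

HONEST FRAMING: elementary arithmetic of reduced fractions; no modular symbols.  Nothing about Manin's conjecture or BSD is proved here.
-/

set_option linter.dupNamespace false
set_option autoImplicit false

namespace Summit.BirchSwinnertonDyer.BirchSwinnertonDyer.Theorems.ManinLocalTwoThree

open Summit.BirchSwinnertonDyer.Rank1Residual.ManinAdditive.TowerExtension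

/-! ## Small helpers -/

/-- An integer dividing a prime power `qᵏ` has absolute value `qᵐ`, `m ≤ k`. -/
theorem natAbs_eq_pow_of_dvd_prime_pow {q : ℕ} (hq : q.Prime) {t : ℤ} {k : ℕ} (h : t ∣ (q : ℤ) ^ k) :
    ∃ m, m ≤ k ∧ t.natAbs = q ^ m := by
  have h' : t.natAbs ∣ q ^ k := by
    have := Int.natAbs_dvd_natAbs.mpr h
    simpa [Int.natAbs_pow] using this
  exact (Nat.dvd_prime_pow hq).mp h'

/-- `P = num · t`, `R = den · t` for the reduced form of `P/R` (`R ≠ 0`), with `t ≠ 0`. -/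
theorem exists_eq_num_mul_of_div {P R : ℤ} (hR : R ≠ 0) :
    ∃ t : ℤ, t ≠ 0 ∧ P = ((P : ℚ) / R).num * t ∧ R = ((P : ℚ) / R).den * t := by
  set y : ℚ := (P : ℚ) / R with hy
  obtain ⟨t, ht⟩ : (y.den : ℤ) ∣ R := by
    have h := Rat.den_dvd P R
    rwa [Rat.divInt_eq_div] at h
  have hRq : (R : ℚ) ≠ 0 := by exact_mod_cast hR
  have hden : (y.den : ℚ) ≠ 0 := by exact_mod_cast y.den_pos.ne'
  refine ⟨t, ?_, ?_, ht⟩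
  · rintro rfl
    rw [mul_zero] at ht
    exact hR ht
  · have h1 : (y.num : ℚ) / y.den = (P : ℚ) / R := by rw [Rat.num_div_den]
    rw [div_eq_div_iff hden hRq] at h1
    have hR' : (R : ℚ) = (y.den : ℚ) * t := by exact_mod_cast ht
    rw [hR'] at h1
    have h2 : (P : ℚ) = y.num * t := by
      have h3 : (y.den : ℚ) * (P - y.num * t) = 0 := by linear_combination -h1
      rcases mul_eq_zero.mp h3 with h4 | h4
      · exact absurd h4 hden
      · linear_combination h4
    exact_mod_cast h2

/-- `gcd(num, den) = 1` in the `Int.gcd` form used by `QFareyAdj`. -/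
theorem Rat.int_gcd_num_den (x : ℚ) : Int.gcd x.num x.den = 1 := by
  have h := x.reduced
  unfold Int.gcd
  simpa using h

/-- In `ZMod N`, `N ≥ 2`, `q` prime to `N`: `±qⁿ ≠ 0`. -/
theorem zmod_pow_ne_zero_of_coprime {N q : ℕ} (hN : 2 ≤ N) (hqN : q.Coprime N) (n : ℕ) :
    (q : ZMod N) ^ n ≠ 0 ∧ -((q : ZMod N) ^ n) ≠ 0 := by
  haveI : Fact (1 < N) := ⟨hN⟩
  have hu : IsUnit ((q : ZMod N) ^ n) := ((ZMod.isUnit_iff_coprime q N).mpr hqN).pow n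
  exact ⟨hu.ne_zero, neg_ne_zero.mpr hu.ne_zero⟩

/-- In `ZMod N`: if `δ · (±qᵐ) = ±qⁿ` then `δ = ±qᵉ` for some `e` (uses `q^{φ(N)} = 1`). -/
theorem zmod_eq_pm_pow_of_mul_pm_pow {N q : ℕ} (hN : 1 ≤ N) (hqN : q.Coprime N) {δ : ZMod N} {m n : ℕ}
    {s s' : ZMod N} (hs : s = 1 ∨ s = -1) (hs' : s' = 1 ∨ s' = -1)
    (h : δ * (s * (q : ZMod N) ^ m) = s' * (q : ZMod N) ^ n) :
    ∃ e : ℕ, δ = (q : ZMod N) ^ e ∨ δ = -((q : ZMod N) ^ e) := by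
  haveI : NeZero N := ⟨by omega⟩
  have hφ : (q : ZMod N) ^ Nat.totient N = 1 := zmod_pow_totient_eq_one_of_coprime hqN
  have hφpos : 1 ≤ Nat.totient N := Nat.totient_pos.mpr (by omega)
  -- δ = δ · q^{m φ} = (δ q^m) q^{m (φ - 1)}
  have hkey : δ = δ * (q : ZMod N) ^ m * (q : ZMod N) ^ (m * (Nat.totient N - 1)) := by
    rw [mul_assoc, ← pow_add, show m + m * (Nat.totient N - 1) = Nat.totient N * m by
      obtain ⟨t, ht⟩ : ∃ t, Nat.totient N = t + 1 := ⟨_, (Nat.sub_add_cancel hφpos).symm⟩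
      rw [ht, Nat.add_sub_cancel]; ring, pow_mul, hφ, one_pow, mul_one]
  refine ⟨n + m * (Nat.totient N - 1), ?_⟩
  have hss : s * s = 1 := by rcases hs with rfl | rfl <;> simp
  have h2 : δ * (q : ZMod N) ^ m = s * s' * (q : ZMod N) ^ n := by
    calc δ * (q : ZMod N) ^ m = s * s * (δ * (q : ZMod N) ^ m) := by rw [hss, one_mul]
      _ = s * (δ * (s * (q : ZMod N) ^ m)) := by ring
      _ = s * (s' * (q : ZMod N) ^ n) := by rw [h]
      _ = s * s' * (q : ZMod N) ^ n := by ring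
  rw [hkey, h2, pow_add]
  rcases hs with rfl | rfl <;> rcases hs' with rfl | rfl
  · left; ring
  · right; ring
  · right; ring
  · left; ring

/-! ## LEMMA T — integral Möbius maps of S-congruence shape act on the fibre and transport q-Farey edges -/

section Transport

variable {N q : ℕ} {a b c d : ℤ} {k : ℕ}

/-- `(a x + b)/(c x + d) = P/R` with `P = a·num + b·den`, `R = c·num + d·den`. -/
theorem moebius_eq_div (x : ℚ) (hR : c * x.num + d * x.den ≠ 0) :
    ((a : ℚ) * x + b) / ((c : ℚ) * x + d) = ((a * x.num + b * x.den : ℤ) : ℚ) / ((c * x.num + d * x.den : ℤ) : ℚ) := by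
  have hden : (x.den : ℚ) ≠ 0 := by exact_mod_cast x.den_pos.ne'
  have hx : x = (x.num : ℚ) / x.den := (Rat.num_div_den x).symm
  have hRq : ((c * x.num + d * x.den : ℤ) : ℚ) ≠ 0 := by exact_mod_cast hR
  conv_lhs => rw [hx]
  rw [div_eq_div_iff ?_ hRq]
  · push_cast
    field_simp
  · intro h0
    apply hRq
    push_cast
    have : (c : ℚ) * x.num + d * x.den = ((c : ℚ) * (x.num / x.den) + d) * x.den := by field_simp
    rw [this, h0, zero_mul]

/-- T1: on the fibre the denominator `c·num + d·den` does not vanish (`N ≥ 2`, `N ∣ c`, `d ≡ ±qⁱ`, `den ≡ ±qᵉ`). -/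
theorem moebius_den_ne_zero (hN : 2 ≤ N) (hqN : q.Coprime N) (hc : (N : ℤ) ∣ c)
    (hd : ∃ i : ℕ, (d : ZMod N) = (q : ZMod N) ^ i ∨ (d : ZMod N) = -((q : ZMod N) ^ i))
    (x : ℚ) (hx : InFibre N q x.den) : c * x.num + d * x.den ≠ 0 := by
  obtain ⟨i, hi⟩ := hd
  obtain ⟨_, e, he⟩ := hx
  intro h0
  have h1 : ((c * x.num + d * x.den : ℤ) : ZMod N) = 0 := by rw [h0, Int.cast_zero]
  have hc0 : (c : ZMod N) = 0 := (ZMod.intCast_zmod_eq_zero_iff_dvd c N).mpr hc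
  push_cast at h1
  rw [hc0, zero_mul, zero_add] at h1
  have hne := zmod_pow_ne_zero_of_coprime hN hqN (i + e)
  rcases hi with hi | hi <;> rcases he with he | he <;> rw [hi, he] at h1
  · exact hne.1 (by rw [pow_add]; exact h1)
  · exact hne.2 (by rw [pow_add]; linear_combination h1)
  · exact hne.2 (by rw [pow_add]; linear_combination h1)
  · exact hne.1 (by rw [pow_add]; linear_combination h1)

/-- T1 in rational form: `c x + d ≠ 0`. -/
theorem moebius_den_ne_zero' (hN : 2 ≤ N) (hqN : q.Coprime N) (hc : (N : ℤ) ∣ c)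
    (hd : ∃ i : ℕ, (d : ZMod N) = (q : ZMod N) ^ i ∨ (d : ZMod N) = -((q : ZMod N) ^ i))
    (x : ℚ) (hx : InFibre N q x.den) : (c : ℚ) * x + d ≠ 0 := by
  have hR := moebius_den_ne_zero hN hqN hc hd x hx
  have hden : (x.den : ℚ) ≠ 0 := by exact_mod_cast x.den_pos.ne'
  intro h0
  apply hR
  have h1 : ((c * x.num + d * x.den : ℤ) : ℚ) = ((c : ℚ) * x + d) * x.den := by
    push_cast
    rw [add_mul, mul_assoc, Rat.mul_den_eq_num]
  exact_mod_cast (show ((c * x.num + d * x.den : ℤ) : ℚ) = 0 by rw [h1, h0, zero_mul])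

/-- The reduced form of the image: `P = ν t`, `R = δ t` with `|t|` a power of `q` (adjugate trick: `t ∣ qᵏ·num`, `t ∣ qᵏ·den`). -/
theorem exists_moebius_num_den (hq : q.Prime) (hdet : a * d - b * c = (q : ℤ) ^ k) (x : ℚ)
    (hR : c * x.num + d * x.den ≠ 0) :
    ∃ (t : ℤ) (m : ℕ), t ≠ 0 ∧ t.natAbs = q ^ m ∧
      a * x.num + b * x.den = (((a * x.num + b * x.den : ℤ) : ℚ) / ((c * x.num + d * x.den : ℤ) : ℚ)).num * t ∧
      c * x.num + d * x.den = (((a * x.num + b * x.den : ℤ) : ℚ) / ((c * x.num + d * x.den : ℤ) : ℚ)).den * t := by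
  obtain ⟨t, ht0, hP, hR'⟩ := exists_eq_num_mul_of_div (P := a * x.num + b * x.den) hR
  set ν := (((a * x.num + b * x.den : ℤ) : ℚ) / ((c * x.num + d * x.den : ℤ) : ℚ)).num
  set δ := (((a * x.num + b * x.den : ℤ) : ℚ) / ((c * x.num + d * x.den : ℤ) : ℚ)).den
  -- `t ∣ qᵏ num` and `t ∣ qᵏ den`
  have h1 : t ∣ (q : ℤ) ^ k * x.num := by
    refine ⟨d * ν - b * δ, ?_⟩
    have : (q : ℤ) ^ k * x.num = d * (a * x.num + b * x.den) - b * (c * x.num + d * x.den) := by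
      linear_combination -x.num * hdet
    rw [this, hP, hR']; ring
  have h2 : t ∣ (q : ℤ) ^ k * x.den := by
    refine ⟨a * δ - c * ν, ?_⟩
    have : (q : ℤ) ^ k * x.den = a * (c * x.num + d * x.den) - c * (a * x.num + b * x.den) := by
      linear_combination -(x.den : ℤ) * hdet
    rw [this, hP, hR']; ring
  have hcop : IsCoprime x.num (x.den : ℤ) := Int.isCoprime_iff_gcd_eq_one.mpr (Rat.int_gcd_num_den x)
  obtain ⟨u, v, huv⟩ := hcop
  have h3 : t ∣ (q : ℤ) ^ k := by
    have : (q : ℤ) ^ k = u * ((q : ℤ) ^ k * x.num) + v * ((q : ℤ) ^ k * x.den) := by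
      linear_combination -((q : ℤ) ^ k) * huv
    rw [this]
    exact dvd_add (dvd_mul_of_dvd_right h1 u) (dvd_mul_of_dvd_right h2 v)
  obtain ⟨m, -, hm⟩ := natAbs_eq_pow_of_dvd_prime_pow hq h3
  exact ⟨t, m, ht0, hm, hP, hR'⟩

/-- T2: the image of a fibre vertex is a fibre vertex. -/
theorem inFibre_den_moebius (hN : 2 ≤ N) (hq : q.Prime) (hqN : q.Coprime N)
    (hdet : a * d - b * c = (q : ℤ) ^ k) (hc : (N : ℤ) ∣ c)
    (hd : ∃ i : ℕ, (d : ZMod N) = (q : ZMod N) ^ i ∨ (d : ZMod N) = -((q : ZMod N) ^ i))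
    (x : ℚ) (hx : InFibre N q x.den) :
    InFibre N q (((a : ℚ) * x + b) / ((c : ℚ) * x + d)).den := by
  have hR := moebius_den_ne_zero hN hqN hc hd x hx
  rw [moebius_eq_div x hR]
  obtain ⟨t, m, ht0, htm, hP, hR'⟩ := exists_moebius_num_den hq hdet x hR
  set y := ((a * x.num + b * x.den : ℤ) : ℚ) / ((c * x.num + d * x.den : ℤ) : ℚ)
  obtain ⟨i, hi⟩ := hd
  obtain ⟨_, e, he⟩ := hx
  have hc0 : (c : ZMod N) = 0 := (ZMod.intCast_zmod_eq_zero_iff_dvd c N).mpr hc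
  -- the residue of `R = δ t`
  have hRmod : ((y.den : ℕ) : ZMod N) * (t : ZMod N) = (d : ZMod N) * (x.den : ZMod N) := by
    have h := congrArg (Int.cast : ℤ → ZMod N) hR'
    push_cast at h
    rw [hc0, zero_mul, zero_add] at h
    exact h.symm
  have ht : (t : ZMod N) = (q : ZMod N) ^ m ∨ (t : ZMod N) = -((q : ZMod N) ^ m) := by
    rcases Int.natAbs_eq t with h | h <;> rw [h, htm]
    · left; push_cast; rfl
    · right; push_cast; rfl
  haveI : Fact (1 < N) := ⟨hN⟩
  refine ⟨?_, ?_⟩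
  · -- coprimality: `δ̄ t̄` is a unit
    rw [← ZMod.isUnit_iff_coprime]
    have hu : IsUnit (((y.den : ℕ) : ZMod N) * (t : ZMod N)) := by
      rw [hRmod]
      have hq' : IsUnit (q : ZMod N) := (ZMod.isUnit_iff_coprime q N).mpr hqN
      refine IsUnit.mul ?_ ?_
      · rcases hi with hi | hi <;> rw [hi]
        · exact hq'.pow i
        · exact (hq'.pow i).neg
      · rcases he with he | he <;> rw [he]
        · exact hq'.pow e
        · exact (hq'.pow e).neg
    exact isUnit_of_mul_isUnit_left hu
  · -- `δ̄ (± q^m) = (± q^i)(± q^e)`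
    obtain ⟨s, hs, hts⟩ : ∃ s : ZMod N, (s = 1 ∨ s = -1) ∧ (t : ZMod N) = s * (q : ZMod N) ^ m := by
      rcases ht with h | h
      · exact ⟨1, Or.inl rfl, by rw [h, one_mul]⟩
      · exact ⟨-1, Or.inr rfl, by rw [h]; ring⟩
    obtain ⟨s', hs', hds'⟩ : ∃ s' : ZMod N, (s' = 1 ∨ s' = -1) ∧
        (d : ZMod N) * (x.den : ZMod N) = s' * (q : ZMod N) ^ (i + e) := by
      rcases hi with hi | hi <;> rcases he with he | he <;> rw [hi, he, pow_add]
      · exact ⟨1, Or.inl rfl, by ring⟩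
      · exact ⟨-1, Or.inr rfl, by ring⟩
      · exact ⟨-1, Or.inr rfl, by ring⟩
      · exact ⟨1, Or.inl rfl, by ring⟩
    have hmain : ((y.den : ℕ) : ZMod N) * (s * (q : ZMod N) ^ m) = s' * (q : ZMod N) ^ (i + e) := by
      rw [← hts, ← hds']
      exact hRmod
    exact zmod_eq_pm_pow_of_mul_pm_pow (by omega) hqN hs hs' hmain

/-- T3: q-Farey edges are transported (cross-differences scale by `det = qᵏ`, reduced forms divide out powers of `q`). -/
theorem qFareyAdj_moebius (hN : 2 ≤ N) (hq : q.Prime) (hqN : q.Coprime N)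
    (hdet : a * d - b * c = (q : ℤ) ^ k) (hc : (N : ℤ) ∣ c)
    (hd : ∃ i : ℕ, (d : ZMod N) = (q : ZMod N) ^ i ∨ (d : ZMod N) = -((q : ZMod N) ^ i))
    (x x' : ℚ) (hadj : QFareyAdj N q (x.num, x.den) (x'.num, x'.den)) :
    QFareyAdj N q ((((a : ℚ) * x + b) / ((c : ℚ) * x + d)).num, (((a : ℚ) * x + b) / ((c : ℚ) * x + d)).den)
      ((((a : ℚ) * x' + b) / ((c : ℚ) * x' + d)).num, (((a : ℚ) * x' + b) / ((c : ℚ) * x' + d)).den) := by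
  obtain ⟨-, -, -, -, hx, hx', e, he⟩ := hadj
  simp only at hx hx' he
  have hfx := inFibre_den_moebius hN hq hqN hdet hc hd x hx
  have hfx' := inFibre_den_moebius hN hq hqN hdet hc hd x' hx'
  have hR := moebius_den_ne_zero hN hqN hc hd x hx
  have hR' := moebius_den_ne_zero hN hqN hc hd x' hx'
  rw [moebius_eq_div x hR] at hfx ⊢
  rw [moebius_eq_div x' hR'] at hfx' ⊢
  obtain ⟨t, m, ht0, htm, hP, hRt⟩ := exists_moebius_num_den hq hdet x hR
  obtain ⟨t', m', ht0', htm', hP', hRt'⟩ := exists_moebius_num_den hq hdet x' hR'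
  set y := ((a * x.num + b * x.den : ℤ) : ℚ) / ((c * x.num + d * x.den : ℤ) : ℚ)
  set y' := ((a * x'.num + b * x'.den : ℤ) : ℚ) / ((c * x'.num + d * x'.den : ℤ) : ℚ)
  refine ⟨y.den_pos, y'.den_pos, Rat.int_gcd_num_den y, Rat.int_gcd_num_den y', hfx, hfx', ?_⟩
  simp only
  -- `(ν δ' − ν' δ) t t' = qᵏ (num den' − num' den)`
  have hcross : (y.num * y'.den - y'.num * y.den) * (t * t') =
      (q : ℤ) ^ k * (x.num * x'.den - x'.num * x.den) := by
    have : (q : ℤ) ^ k * (x.num * x'.den - x'.num * x.den) =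
        (a * x.num + b * x.den) * (c * x'.num + d * x'.den) - (a * x'.num + b * x'.den) * (c * x.num + d * x.den) := by
      linear_combination -(x.num * x'.den - x'.num * x.den) * hdet
    rw [this, hP, hRt, hP', hRt']
    ring
  have habs : (y.num * y'.den - y'.num * y.den).natAbs * q ^ (m + m') = q ^ (k + e) := by
    have h1 := congrArg Int.natAbs hcross
    rw [Int.natAbs_mul, Int.natAbs_mul, Int.natAbs_mul, htm, htm', Int.natAbs_pow] at h1
    have h2 : (x.num * x'.den - x'.num * x.den).natAbs = q ^ e := by
      have := congrArg Int.natAbs he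
      rwa [Int.natAbs_abs, Int.natAbs_pow, Int.natAbs_natCast] at this
    rw [h2, Int.natAbs_natCast, ← pow_add, ← pow_add] at h1
    exact h1
  have hdvd : (y.num * y'.den - y'.num * y.den).natAbs ∣ q ^ (k + e) := ⟨q ^ (m + m'), habs.symm⟩
  obtain ⟨n, -, hn⟩ := (Nat.dvd_prime_pow hq).mp hdvd
  refine ⟨n, ?_⟩
  rw [Int.abs_eq_natAbs, hn]
  push_cast
  rfl

end Transport

end Summit.BirchSwinnertonDyer.BirchSwinnertonDyer.Theorems.ManinLocalTwoThree
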